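import Summits.BirchSwinnertonDyer.Rank1Residual.X11b.KolyvaginShaAtPrimeOfProp37
import Summits.BirchSwinnertonDyer.Rank1Residual.X11b.KolyvaginHGZOfGross1991
import HarnessLib

/-!
# `Ш(E/K)[p^∞]` at ONE odd surjective prime `p` WITHOUT the Kodaira–Néron sub-class (KN_p):
# finite, and killed by `p^{m}` when `p^{m+1} ∤ y_K` — modulo TWO NAMED facts (Gross 1991
# Prop. 3.7 (2) and §6 / [GZ86, III (3.1)] BY NAME), no inline cite-only input, no (KN_p)

Cell `b2b-bsdres`, team x11b3 (N8/O2 = X11b @ 3); seat x11b3-p2 GEN 54 (unit claimed D-0075 →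
BSD:K2/P4 «Kolyvagin-in-kernel»).  Summit-side THEOREM-ONLY file (no definition, no named fact,
no `sorry`); `K : Type`; a general odd prime `p`.

HONEST FRAMING (cell `b2b-bsdres`, run/shared/lean/b2b/bsd-rank1-residual/, verbatim in every
file): the goal of the cell is to DELETE the COMBINATION-SHAPED residual classes of the
Birch–Swinnerton-Dyer formula for ALL analytic-rank `≤ 1` elliptic curves over `ℚ` — "full BSD
formula for every rank `≤ 1` curve in class `C`" assembled STRICTLY from published theorems — so
that the rank-`≤ 1` remainder becomes exactly the CONSTRUCTION-SHAPED classes, which are TYPED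
(missing-input `Prop`s), NOT attempted.  This is not "finishing BSD".  Nothing here is booked; no
mark / label / count / tier moves; X11b @ `p` stays OPEN / CONSTRUCTION-SHAPED (Kolyvagin bounds
`Ш` relative to the Heegner index; it is not `BSD_p`).

WHAT THIS FILE DOES.  The generic-prime X11b Kolyvagin ENDs of record
(`X11b/KolyvaginShaAtPrimeOfProp37`, x11b3-p2 GEN 53: `Ш(E/K)[p^∞]` finite, and
`p^{m+1} ∤ y_K ⟹ p^{m} · Ш(E/K)[p^∞] = 0`, modulo the NAMED fact
`GrossLMS1991.prop37_2_reductionCongruence N W K p`) are stated on the Kodaira–Néron sub-class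
(KN_p) — `hKNm`: `p ∤ ord_v(Δ_min(E/K))` at every multiplicative place `v` of `E/K`, `hKNa`: `p ≠ 3`
or no additive place of Kodaira type IV / IV* — because their receptacle binder `hGZ` ([GZ86,
III (3.1)] as Gross 1991 p. 245 uses it: the Heegner points land in `E⁰(K̄_v)` at the bad places,
after a multiple prime to `p`) was SUPPLIED by Kodaira–Néron (`KolyvaginHloc.hGZ_of_kodairaNeron`).
That input is now the NAMED Literature fact `Gross1991_heegnerPoint_sub_ratTorsion_mem_E0`
(`HeegnerPointsIdentityComponent.lean`), turned into the x11b3 binder character for character by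
`KolyvaginHloc.hGZ_of_gross1991E0` (`X11b/KolyvaginHGZOfGross1991`, this GEN; transport = cell
`bsd-jet`'s `JET/HeegnerE0ReceptacleByName`).  THIS FILE re-issues the two ENDs and the seat's root
END `KolyvaginAssembly.hpoints_at_of_perLevelChoice_of_GZ_of_prop37` WITHOUT (KN_p): the binders
`hKNm` / `hKNa` (resp. `hGZ`) are REPLACED by `(hE0 : Gross1991_heegnerPoint_sub_ratTorsion_mem_E0)`;
every other binder and the conclusion VERBATIM; proof = the hGZ-hypothesis parent
(`…_of_leafInputs_of_poitouTate`, x11b3 GEN 35) with `hPT`, `hrec`, `hCM`, `h53` discharged by the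
tree theorems exactly as in GEN 52 (`poitouTate_sum_localTatePairing_eq_zero_holds`,
`heegnerPointOfConductor_one_galoisConj_holds`, `KolyvaginLeaves.hCM_holds`, `KolyvaginLeaves.h53_holds`),
`hGZ` := `hGZ_of_gross1991E0 hE0 …` and `hγ` := `hγ.endBinder …` under the ENDs' OWN hypotheses
(`_hE`, `_hD`, `hp`, `hp2`, `_hρ`, `hN`).  Net effect (honest): for `E/ℚ` globally minimal without
CM at `N = N_E`, `K` imaginary quadratic Heegner with `d_K ∉ {−3, −4}`, a non-torsion Heegner point
`y_K`, and ANY odd prime `p` with `ρ̄_{E,p}` onto — NO condition on Tamagawa numbers / Kodaira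
types — the finiteness of `Ш(E/K)[p^∞]` and its annihilation by `p^{m}` (`p^{m+1} ∤ y_K`) are
theorems CONDITIONAL on exactly TWO NAMED PUBLISHED FACTS {`GrossLMS1991.prop37_2_reductionCongruence`,
`Gross1991_heegnerPoint_sub_ratTorsion_mem_E0`} (McCallum 1991 §1 Theorem (Kolyvagin) / Gross 1991
Thm. 1.3 (2) at the prime `p`, in kernel form modulo the two printed inputs).  Neither fact is
discharged here (both XL); nothing booked; the (KN_p) ENDs of GEN 52/53 stay as they are (on
(KN_p) they need one fact fewer).

## What is proved

* `KolyvaginDischarged.sha_primary_finite_at_of_gross1991E0_of_prop37` — `Ш(E/K)[p^∞]` finite at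
  `p`, modulo the two NAMED facts + `hN`; NO (KN_p).
* `KolyvaginDischarged.pow_smul_sha_primary_eq_zero_at_of_gross1991E0_of_prop37` —
  `p^{m+1} ∤ y_K ⟹ p^{m} · Ш(E/K)[p^∞] = 0`, same footing.
* `KolyvaginAssembly.hpoints_at_of_perLevelChoice_of_gross1991E0_of_prop37` — the root END
  (McCallum's `hpoints` clause at one prime) from the two NAMED facts, NO `hGZ` binder.

## References

* [GrossLMS1991] B. H. Gross, *Kolyvagin's work on modular elliptic curves*, LMS LNS 153 (1991),
  Thm. 1.3 (2), §2 Prop. 2.1, §3 Prop. 3.7 (2) (p. 240), Prop. 5.3, §6 Prop. 6.2 (1) and its proof (p. 245).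
* [McCallumLMS1991] W. G. McCallum, *Kolyvagin's work on Shafarevich–Tate groups*, same volume,
  §1 Theorem (Kolyvagin), §2 Prop. 2.2, Lemma 5.1.
* [GrossZagier1986Heegner] B. H. Gross, D. B. Zagier, Invent. Math. 84 (1986), III (3.1) (p. 256).
* [SilvermanAEC2009] VII.1 Prop. 1.3 (b), VII.2 Prop. 2.1; [Mazur1977] III §5; [Darmon2004] Thm. 3.6–3.7.

presearch: `lean search 'of_gross1991E0'` → none before this GEN; `rg Gross1991_heegnerPoint_sub_ratTorsion_mem_E0
Summits/…/X11b` → 0 consumers (all x11b3 ENDs on (KN_p)); parents = the tree ENDs named above;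
[corpus: book:editornd-l-functions-arithmetic p0222:L1 (Prop. 6.2 (1) proof), p0217:L19–L22
(Prop. 3.7 (2))]; nothing minted.
-/

noncomputable section

open scoped Classical
open WeierstrassCurve Field NumberField IsDedekindDomain
open Literature.NumberTheory.EllipticCurves Literature.NumberTheory.GaloisRepresentations
open Literature.NumberTheory.EllipticCurves.RingClassField
open Literature.NumberTheory.EllipticCurves.ModularForms
open Literature.NumberTheory.DiophantineGeometry Literature.NumberTheory.DiophantineGeometry.TateAlgorithm
open Literature.NumberTheory.EllipticCurves.GrossLMS1991 (prop37_2_reductionCongruence)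
open Literature.NumberTheory.GaloisCohomology (poitouTate_sum_localTatePairing_eq_zero_holds)
open Summit.BirchSwinnertonDyer.Rank1Residual.X11b.KolyvaginAssembly

namespace Summit.BirchSwinnertonDyer.Rank1Residual.X11b.KolyvaginDischarged

-- `K : Type`: the tree's ring-class class field theory is universe `0`.
variable {K : Type} [Field K] [NumberField K] {N : ℕ} {W : WeierstrassCurve ℚ}

/-- **`Ш(E/K)[p^∞]` finite at ONE odd surjective prime `p` — NO Kodaira–Néron hypothesis — modulo
the TWO NAMED facts `GrossLMS1991.prop37_2_reductionCongruence N W K p` (Gross 1991 Prop. 3.7 (2))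
and `Gross1991_heegnerPoint_sub_ratTorsion_mem_E0` (Gross 1991 §6 ⟸ [GZ86, III (3.1)]), no inline
cite-only input.**  The hGZ-hypothesis parent
`KolyvaginAssembly.sha_primary_finite_at_of_leafInputs_of_poitouTate` with `hPT`, `hrec`, `hCM`,
`h53` SUPPLIED by the tree theorems, `hGZ` SUPPLIED by `KolyvaginHloc.hGZ_of_gross1991E0 hE0` and
`hγ` by `hγ.endBinder`, both under the END's own hypotheses `_hE`, `_hD`, `hp`, `hp2`, `_hρ`, `hN`;
the binders `hKNm` / `hKNa` of the (KN_p) twin `sha_primary_finite_at_of_kodairaNeron_of_prop37`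
are GONE, every other binder and the conclusion VERBATIM.  For `E = W/ℚ` globally minimal, `¬ CM`,
`N = N_E` (`hN`), `K` imaginary quadratic Heegner with `d_K ∉ {−3, −4}`, `P` a non-torsion Heegner
point, `p` odd with `ρ̄_{E,p}` onto: `{c ∈ Ш(E/K) | p^j c = 0}` is finite.  CONDITIONAL on EXACTLY
the two named facts (PUBLISHED, NOT discharged) + `hN`; nothing booked; no mark / count / tier moves.
[cite: McCallumLMS1991, §1 Theorem (Kolyvagin)] [cite: GrossLMS1991, Thm. 1.3 (2), §3 Prop. 3.7 (2) (p. 240), §6 Prop. 6.2 (1) (p. 245)]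
[cite: GrossZagier1986Heegner, III (3.1) Proposition, p. 256] -/
theorem sha_primary_finite_at_of_gross1991E0_of_prop37 [NeZero N]
    [W.IsGloballyMinimal] {p : ℕ} (hp : p.Prime) (hp2 : p ≠ 2)
    (hN : ∀ [W.IsElliptic], N = W.conductorNorm ℤ)
    (hE0 : Gross1991_heegnerPoint_sub_ratTorsion_mem_E0)
    (hγ : prop37_2_reductionCongruence N W K p) :
    ∀ [W.IsElliptic] (_hE : ¬ W.HasCM) (_hK : IsImaginaryQuadratic K)
      (_hD : NumberField.discr K ≠ -3 ∧ NumberField.discr K ≠ -4)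
      (_hH : SatisfiesHeegnerHypothesis N K)
      {P : (W.baseChange K).toAffine.Point} (_hP : IsHeegnerPoint N W K P)
      (_hnt : ¬ IsOfFinAddOrder P) (_hρ : W.HasSurjectiveModNGaloisRep p),
      Set.Finite {c : (W.baseChange K).sha | ∃ j : ℕ, p ^ j • c = 0} := by
  intro _ hE hK hD hH P hP hnt hρ
  exact KolyvaginAssembly.sha_primary_finite_at_of_leafInputs_of_poitouTate hp hp2
    (poitouTate_sum_localTatePairing_eq_zero_holds K) hN
    (heegnerPointOfConductor_one_galoisConj_holds N W K) (KolyvaginLeaves.hCM_holds N W K p)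
    (@fun _ ↦ KolyvaginLeaves.h53_holds hN p)
    (@fun _ hK' hH' Dt _ ι _ _ _ hn hKol d ↦
      KolyvaginHloc.hGZ_of_gross1991E0 hE0 hN hE hK' hD hH' ι Dt hp hp2 hρ hn hKol d)
    (hγ.endBinder (@fun _ ↦ hE) hD hp hp2 (@fun _ ↦ hρ) hN) hE hK hD hH hP hnt hρ

/-- **Kolyvagin's annihilator at ONE odd surjective prime `p` — NO Kodaira–Néron hypothesis:
`p^{m+1} ∤ y_K ⟹ p^{m} · Ш(E/K)[p^∞] = 0` — modulo the TWO NAMED facts** (Gross 1991 Prop. 3.7 (2)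
and §6 / [GZ86, III (3.1)] BY NAME).  The hGZ-hypothesis parent
`KolyvaginAnnihilator.pow_smul_sha_primary_eq_zero_at_of_leafInputs_of_poitouTate` with `hPT`,
`hrec`, `hCM`, `h53` SUPPLIED by the tree theorems, `hGZ` := `KolyvaginHloc.hGZ_of_gross1991E0 hE0`,
`hγ` := `hγ.endBinder`; binders / conclusion otherwise VERBATIM the (KN_p) twin's, minus `hKNm` /
`hKNa`.  CONDITIONAL on EXACTLY the two named facts + `hN`; nothing booked; no mark.
[cite: McCallumLMS1991, §1 Theorem (Kolyvagin), §2 Prop. 2.2, Lemma 5.1]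
[cite: GrossLMS1991, Thm. 1.3 (2), §3 Prop. 3.7 (2), §6 Prop. 6.2 (1) (p. 245)]
[cite: GrossZagier1986Heegner, III (3.1) Proposition, p. 256] -/
theorem pow_smul_sha_primary_eq_zero_at_of_gross1991E0_of_prop37 [NeZero N]
    [W.IsGloballyMinimal] {p : ℕ} (hp : p.Prime) (hp2 : p ≠ 2)
    (hN : ∀ [W.IsElliptic], N = W.conductorNorm ℤ)
    (hE0 : Gross1991_heegnerPoint_sub_ratTorsion_mem_E0)
    (hγ : prop37_2_reductionCongruence N W K p) :
    ∀ [W.IsElliptic] (_hE : ¬ W.HasCM) (_hK : IsImaginaryQuadratic K)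
      (_hD : NumberField.discr K ≠ -3 ∧ NumberField.discr K ≠ -4)
      (_hH : SatisfiesHeegnerHypothesis N K)
      {P : (W.baseChange K).toAffine.Point} (_hP : IsHeegnerPoint N W K P)
      (_hnt : ¬ IsOfFinAddOrder P) (_hρ : W.HasSurjectiveModNGaloisRep p) {m : ℕ}
      (_hm : ∀ Q : (W.baseChange K).toAffine.Point, p ^ (m + 1) • Q ≠ P) (c : (W.baseChange K).sha),
      (∃ j : ℕ, p ^ j • c = 0) → p ^ m • c = 0 := by
  intro _ hE hK hD hH P hP hnt hρ
  exact KolyvaginAnnihilator.pow_smul_sha_primary_eq_zero_at_of_leafInputs_of_poitouTate hp hp2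
    (poitouTate_sum_localTatePairing_eq_zero_holds K) hN
    (heegnerPointOfConductor_one_galoisConj_holds N W K) (KolyvaginLeaves.hCM_holds N W K p)
    (@fun _ ↦ KolyvaginLeaves.h53_holds hN p)
    (@fun _ hK' hH' Dt _ ι _ _ _ hn hKol d ↦
      KolyvaginHloc.hGZ_of_gross1991E0 hE0 hN hE hK' hD hH' ι Dt hp hp2 hρ hn hKol d)
    (hγ.endBinder (@fun _ ↦ hE) hD hp hp2 (@fun _ ↦ hρ) hN) hE hK hD hH hP hnt hρ

end Summit.BirchSwinnertonDyer.Rank1Residual.X11b.KolyvaginDischarged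

namespace Summit.BirchSwinnertonDyer.Rank1Residual.X11b.KolyvaginAssembly

-- `K : Type`: the tree's ring-class class field theory is universe `0`.
variable {K : Type} [Field K] [NumberField K] {N : ℕ} {W : WeierstrassCurve ℚ}

/-- **The seat's root END at one prime with BOTH printed point-inputs BY NAME**: McCallum's
`hpoints` clause of `Kolyvagin1990_sha_primary_finite_of_pointsM_of_reciprocityM` at `(p, M)` —
`KolyvaginAssembly.hpoints_at_of_perLevelChoice_of_GZ_of_prop37` (x11b3-p2 GEN 53) with its binder
`hGZ` ([GZ86, III (3.1)] at `p`) SUPPLIED by `KolyvaginHloc.hGZ_of_gross1991E0 hE0` under the root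
END's own hypotheses (`hN`, `hE`, `hK`, `hD34`, `hH`, `hρ`); every other binder and the conclusion
VERBATIM.  CONDITIONAL on EXACTLY the two named facts {`GrossLMS1991.prop37_2_reductionCongruence N W K p`,
`Gross1991_heegnerPoint_sub_ratTorsion_mem_E0`} (PUBLISHED, NOT discharged); NO `hGZ`, NO (KN_p);
nothing booked; no mark / count / tier moves.
[cite: McCallumLMS1991, §1 Theorem (Kolyvagin), Prop. 5.2] [cite: GrossLMS1991, §3 Prop. 3.7 (2), Prop. 5.3, §6 Prop. 6.2 (1)]
[cite: GrossZagier1986Heegner, III (3.1) Proposition, p. 256] -/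
theorem hpoints_at_of_perLevelChoice_of_gross1991E0_of_prop37 [NeZero N] [W.IsGloballyMinimal]
    [W.IsElliptic] (hN : N = W.conductorNorm ℤ) (hE : ¬ W.HasCM) (hK : IsImaginaryQuadratic K)
    (hD34 : NumberField.discr K ≠ -3 ∧ NumberField.discr K ≠ -4)
    (hH : SatisfiesHeegnerHypothesis N K) {P : (W.baseChange K).toAffine.Point}
    (hHP : IsHeegnerPoint N W K P) {p : ℕ} (hp : p.Prime) (hp2 : p ≠ 2)
    (hρ : W.HasSurjectiveModNGaloisRep p)
    (hE0 : Gross1991_heegnerPoint_sub_ratTorsion_mem_E0)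
    (hγ : prop37_2_reductionCongruence N W K p) :
    ∀ {M : ℕ} (_hM : 1 ≤ M)
      (hdiv : ∀ Q : geomPoints (W.baseChange K), ∃ R, ((p ^ M : ℕ) : ℤ) • R = Q)
      (c : K ≃ₐ[ℚ] K) (_hc : c ≠ 1),
      ∃ (ε : ℤ) (τ : AlgebraicClosure K ≃+* AlgebraicClosure K) (hτ : IsLiftOfAut c τ)
        (A : ℕ → AddSubgroup (geomPoints (W.baseChange K)))
        (hA : ∀ m, KolyvaginCocycle.IsAdmissible (Field.absoluteGaloisGroup K) (A m)
          ((p ^ M : ℕ) : ℤ))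
        (Pt : ℕ → geomPoints (W.baseChange K))
        (hPt : ∀ m, Pt m ∈
          KolyvaginCocycle.invPoints (Field.absoluteGaloisGroup K) (A m) ((p ^ M : ℕ) : ℤ)),
        (ε = 1 ∨ ε = -1) ∧
        IsOfFinAddOrder (Affine.Point.map (W' := W) (c : K →ₐ[ℚ] K) P - ε • P) ∧
        (∀ m, ∀ a ∈ A m, hτ.pointsMap W a ∈ A m) ∧
        Pt 1 = toGeomPoints (W.baseChange K) P ∧
        (∀ m : ℕ, Squarefree m →
          (∀ q ∈ m.primeFactors, IsKolyvaginPrime N W K p q ∧ FrobEqFrobInfty W K (p ^ M) q) →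
          (∃ B ∈ A m, hτ.pointsMap W (Pt m) =
            (ε * (-1) ^ m.primeFactors.card) • Pt m + ((p ^ M : ℕ) : ℤ) • B) ∧
          (∀ v : HeightOneSpectrum (𝓞 K), (m : 𝓞 K) ∉ v.asIdeal →
            kolyvaginClass (W.baseChange K) _ hdiv (hA m) (Pt m) (hPt m) ∈
              selmerLocalKer (W.baseChange K) (v.adicCompletion K) ((p ^ M : ℕ) : ℤ)) ∧
          (∀ ℓ : ℕ, ℓ.Prime → ℓ ∣ m → ∀ v : HeightOneSpectrum (𝓞 K), (ℓ : 𝓞 K) ∈ v.asIdeal →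
            ∀ a : ℕ, (((p : ℤ) ^ a) •
                kolyvaginClass (W.baseChange K) _ hdiv (hA m) (Pt m) (hPt m) ∈
                selmerLocalKer (W.baseChange K) (v.adicCompletion K) ((p ^ M : ℕ) : ℤ) ↔
              ((p : ℤ) ^ a) • kolyvaginClass (W.baseChange K) _ hdiv (hA (m / ℓ)) (Pt (m / ℓ))
                  (hPt (m / ℓ)) ∈
                (W.baseChange K).torsionLocalKer (v.adicCompletion K) ((p ^ M : ℕ) : ℤ)))) :=
  hpoints_at_of_perLevelChoice_of_GZ_of_prop37 hN hE hK hD34 hH hHP hp hp2 hρ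
    (@fun _ hK' hH' Dt _ ι _ _ _ hn hKol d ↦
      KolyvaginHloc.hGZ_of_gross1991E0 hE0 hN hE hK' hD34 hH' ι Dt hp hp2 hρ hn hKol d) hγ

end Summit.BirchSwinnertonDyer.Rank1Residual.X11b.KolyvaginAssembly

end
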